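import Summits.BirchSwinnertonDyer.BirchSwinnertonDyer.Theorems.ThetaPartnerAtTwoSignedKatoUpToAtTwoKatoBKCoreKZLit
import Summits.BirchSwinnertonDyer.BirchSwinnertonDyer.Theorems.ThetaPartnerAtTwoSignedKatoUpToAtTwoOfPubKBK
import Summits.BirchSwinnertonDyer.BirchSwinnertonDyer.Theorems.ThetaPartnerAtTwoSignedKatoUpToAtTwoKatoBKBricks
import Summits.BirchSwinnertonDyer.BirchSwinnertonDyer.Theorems.ThetaPartnerAtTwoSignedKatoUpToAtTwoCorePairCertificates
import Summits.BirchSwinnertonDyer.BirchSwinnertonDyer.Theses.ResidualThetaTransportAtTwo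
import Literature.NumberTheory.EllipticCurves.Kato2004.EulerSystemTatePairingValuesTwo
import HarnessLib

/-!
# Route `ThetaPartnerAtTwo` (TP2) / `ResidualThetaTransportAtTwo` (RTT), crux K3 `SignedKatoDivisibilityUpToAtTwo` (stmt-BirchSwinnertonDyer-20308)
# and K3P′ `SignedKatoDivisibilityUpToAtTwoOfPub` (stmt-BirchSwinnertonDyer-25631), line `colemanrat` v16 — THE CERTIFICATES BY NAME OVER NAMED
# LITERATURE FACTS ONLY: K3P′ ⟸ `Kato2004.exists_eulerSystem_expStar_tatePairing_values_two` ALONE;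
# K3 (TP2 and RTT readings) ⟸ {`Kato2004.thm13_4_two_lengthAt_fineSelmerDualContra_le_of_isEulerSystemClassTwo`,
# `rank_eq_analyticRank_of_analyticRank_le_one`, `Kato2004.exists_eulerSystem_expStar_tatePairing_values_two`}

Lead prover `bsd-wall-tp2-p2x` g8 (cell `bsd-wall`). The line's last displayed residue CORE_KZ_Lit is, since p640688, the NAMED Literature fact
`Kato2004.exists_eulerSystem_expStar_tatePairing_values_two` (`Literature/NumberTheory/EllipticCurves/Kato2004/EulerSystemTatePairingValuesTwo.lean`:
Kato 2004 Thm. 12.5 (1) with (8.1.3)/Ex. 13.3, 8.12, 9.7, 6.6 (1) read on the layer Tate pairing — Rubin 1998 §5 (2)/Thm. 7.1, Kobayashi 2003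
(8.23)/(8.29)/Prop. 8.25, Bloch–Kato 1990 §3). This file composes it with the KERNEL of the line: `KatoBK.coreKZ_of_coreKZLit` (lead g8, p640162) →
the CORE_KZ socket `KatoBK.corePairChiPrim_of_coreKZ_of_bricks` (w3 g8) with its four kernel bricks by name (`cuspBrick_unconditional` — Rohrlich's
theorem is the tree THEOREM `Rohrlich1984_nonvanishing_twists_holds` —, `heckeBaseTwo_brick`, `logBaseTwo_brick`, `katoTrivialValuesTwo_brick`) →
w3 g6's certificates `CoreChi.signedKatoDivisibilityUpToAtTwoOfPub_of_corePairChiPrim` / `…_of_contraFact_of_gzk_of_corePairChiPrim`. RESULT: every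
hypothesis of the three theorems below is a NAMED `def … : Prop` of `Literature/` (PUBLISHED inputs: Kato's zeta-value/reciprocity package at `2`;
Kato Thm. 13.4 (2) at `2`; Gross–Zagier–Kolyvagin), none of them proved in the tree. HONEST FRAMING: compositions only (no definition, no named fact,
no instance, no `sorry`); CONDITIONAL theorems displaying their hypotheses by name; they close no item (the items close only when the facts' `_holds`
land); K3 / K3P′ are NOT settled; BSD is NOT proved by any of this.
-/

set_option autoImplicit false
-- the Theorems namespace of this sub repeats the summit name by design (D-0017 nested layout)
set_option linter.dupNamespace false

noncomputable section

set_option backward.isDefEq.respectTransparency false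

open Literature.NumberTheory.EllipticCurves Literature.NumberTheory.EllipticCurves.Kato2004

namespace Summit.BirchSwinnertonDyer.BirchSwinnertonDyer.Theorems.SignedKatoOffTwo.KatoBK

/-- **K3P′ BY NAME ⟸ ONE NAMED LITERATURE FACT** (TP2 decl `SignedKatoDivisibilityUpToAtTwoOfPub`, item stmt-BirchSwinnertonDyer-25631):
`Kato2004.exists_eulerSystem_expStar_tatePairing_values_two` (Kato's `2`-adic zeta elements of `T₂E` with their values and the layer Tate pairing law)
implies Kato's signed divisibility up to a `2`-power in its published-inputs form. Chain: `coreKZ_of_coreKZLit` → CORE_KZ socket with the four kernel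
bricks → `CoreChi.signedKatoDivisibilityUpToAtTwoOfPub_of_corePairChiPrim`. CONDITIONAL on the displayed fact (unproved in the tree); closes nothing
by itself; BSD is not proved by this.
[cite: Kato2004Asterisque, Thm. 12.5 (1) (pp. 221–222), Ex. 13.3 (p. 225), Thm. 13.4 (2) (p. 226)] [cite: Rubin1998Durham, §5 display (2), Thm. 7.1]
[cite: Kobayashi2003, (8.23), (8.29), Prop. 8.25, Thm. 6.3] -/
theorem signedKatoDivisibilityUpToAtTwoOfPub_of_kato_tatePairing_fact
    (hF : Kato2004.exists_eulerSystem_expStar_tatePairing_values_two) :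
    Summit.BirchSwinnertonDyer.BirchSwinnertonDyer.Theses.ThetaPartnerAtTwo.SignedKatoDivisibilityUpToAtTwoOfPub :=
  CoreChi.signedKatoDivisibilityUpToAtTwoOfPub_of_corePairChiPrim
    (corePairChiPrim_of_coreKZ_of_bricks (coreKZ_of_coreKZLit hF) cuspBrick_unconditional heckeBaseTwo_brick logBaseTwo_brick
      katoTrivialValuesTwo_brick)

/-- **K3 BY NAME ⟸ THREE NAMED LITERATURE FACTS** (TP2 decl `SignedKatoDivisibilityUpToAtTwo`, item stmt-BirchSwinnertonDyer-20308): Kato Thm. 13.4 (2)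
at `p = 2` (contragredient fine dual, `Kato2004.thm13_4_two_lengthAt_fineSelmerDualContra_le_of_isEulerSystemClassTwo`), Gross–Zagier–Kolyvagin
(`rank_eq_analyticRank_of_analyticRank_le_one`) and Kato's zeta-value / reciprocity package at `2` (`Kato2004.exists_eulerSystem_expStar_tatePairing_values_two`)
imply Kato's signed divisibility `char(X⁺) ∣ 2^m·ϖ·L_Kob` on the theta habitat. Chain: `coreKZ_of_coreKZLit` → CORE_KZ socket (four kernel bricks) →
`CoreChi.signedKatoDivisibilityUpToAtTwo_of_contraFact_of_gzk_of_corePairChiPrim`. CONDITIONAL on the three displayed facts (none proved in the tree);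
closes nothing by itself; BSD is not proved by this.
[cite: Kato2004Asterisque, Thm. 13.4 (2) (p. 226), Thm. 12.5 (1) (pp. 221–222), Ex. 13.3 (p. 225)] [cite: GrossZagier1986, Thm. I.6.3] [cite: Kolyvagin1990, Thm. A]
[cite: Rubin1998Durham, §5 display (2), Thm. 7.1] [cite: Kobayashi2003, (8.23), (8.29), Prop. 8.25] -/
theorem signedKatoDivisibilityUpToAtTwo_of_kato_facts_of_gzk
    (hK2 : Kato2004.thm13_4_two_lengthAt_fineSelmerDualContra_le_of_isEulerSystemClassTwo)
    (hGZK : rank_eq_analyticRank_of_analyticRank_le_one)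
    (hF : Kato2004.exists_eulerSystem_expStar_tatePairing_values_two) :
    Summit.BirchSwinnertonDyer.BirchSwinnertonDyer.Theses.ThetaPartnerAtTwo.SignedKatoDivisibilityUpToAtTwo :=
  CoreChi.signedKatoDivisibilityUpToAtTwo_of_contraFact_of_gzk_of_corePairChiPrim hK2 hGZK
    (corePairChiPrim_of_coreKZ_of_bricks (coreKZ_of_coreKZLit hF) cuspBrick_unconditional heckeBaseTwo_brick logBaseTwo_brick
      katoTrivialValuesTwo_brick)

/-- The same certificate read on the second route wanting K3 (`route-BirchSwinnertonDyer-ResidualThetaTransportAtTwo`; byte-identical body).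
CONDITIONAL; closes nothing by itself; BSD is not proved by this. [cite: Kato2004Asterisque, Thm. 13.4 (2) (p. 226), Thm. 12.5 (1) (pp. 221–222)] -/
theorem signedKatoDivisibilityUpToAtTwo_rtt_of_kato_facts_of_gzk
    (hK2 : Kato2004.thm13_4_two_lengthAt_fineSelmerDualContra_le_of_isEulerSystemClassTwo)
    (hGZK : rank_eq_analyticRank_of_analyticRank_le_one)
    (hF : Kato2004.exists_eulerSystem_expStar_tatePairing_values_two) :
    Summit.BirchSwinnertonDyer.BirchSwinnertonDyer.Theses.ResidualThetaTransportAtTwo.SignedKatoDivisibilityUpToAtTwo :=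
  signedKatoDivisibilityUpToAtTwo_of_kato_facts_of_gzk hK2 hGZK hF

end Summit.BirchSwinnertonDyer.BirchSwinnertonDyer.Theorems.SignedKatoOffTwo.KatoBK

end
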